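import Summits.HubbardSuperconductivity.HubbardSuperconductivity.Theses.ParentFirstSMA
import Literature.MathematicalPhysics.QuantumLattice.HubbardLiebBasis
import Literature.MathematicalPhysics.QuantumLattice.FermionOperatorsProofs
import Literature.MathematicalPhysics.QuantumLattice.HubbardModelParticleHoleProofs

/-!
# Route `ParentFirstSMA`: Feynman's single-mode bound, the Mott gap from a coherent hole, and the Assembly

Three items of route `ParentFirstSMA` (sub-problem `HubbardSuperconductivity`):

* `ProjectedSingleModeBound` (stmt-HubbardSuperconductivity-2357): for a ground state `φ` of
  `H = hubbardTorus 2 L 1 U` in the `N`-particle sector and any matrix `A` commuting with the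
  doublon number `D = Σ_x n_{x↑} n_{x↓}` such that `Aφ` is an `M`-particle vector,
  `‖Aφ‖² (E(M) − E(N)) ≤ Re⟨Aφ, [T, A]φ⟩` (`T = hubbardTorus 2 L 1 0`): `H = T + U D`,
  `H(Aφ) = E(N) Aφ + [T, A]φ` exactly (`U` drops out), and the variational principle in the
  `M`-particle sector (`groundEnergy_mul_norm_le`). Feynman, Phys. Rev. 94 (1954) 262, one-sided.
* `MottGapFromSingleMode` (stmt-HubbardSuperconductivity-2358): with `A = P`, the projected
  re-creation `Σ_x e^{2πik·x/L} c†_{x↓}(1 − n_{x↑})` of a `↓` electron on EMPTY sites (which commutes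
  with `D` term by term and raises the particle number by one), `N = L² − 1`, `M = L²`, and the
  particle–hole identity `E(L² − 1) = E(L² + 1) − U` on the even torus
  (`groundEnergyAt_fermionTorus_particleHole`): `Z (U − Δ_c(L)) = 2 Z (E(L²) − E(L² − 1)) ≤ 2f`.
  Lieb–Wu, Physica A 321 (2003) 1, eq. (3).
* `Assembly` (stmt-HubbardSuperconductivity-2359): the route's deciding theorem `closes` fed with
  the proved `MottGapFromSingleMode`.

No definitions are introduced.
-/

-- the mandated namespace `Summit.<Summit>.<Problem>.Theorems` repeats `HubbardSuperconductivity`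
-- (single-problem summit, D-0017), which the `dupNamespace` linter flags on every declaration
set_option linter.dupNamespace false

noncomputable section

namespace Summit.HubbardSuperconductivity.HubbardSuperconductivity.Theorems.ParentFirstSMA

open Matrix Literature.MathematicalPhysics.QuantumLattice
open Summit.HubbardSuperconductivity.HubbardSuperconductivity.Theses.ParentFirstSMA

/-! ### Feynman's single-mode bound -/

section SingleMode

variable {ι : Type*} [Fintype ι]

/-- **Single-mode bound, abstract form.** If `H = T + U • D`, `A` commutes with `D`, `φ` is a
ground state of `H` in the `N`-particle sector and `Aφ` is an `M`-particle vector, then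
`‖Aφ‖² (E₀(H, M) − E₀(H, N)) ≤ Re⟨Aφ, (TA − AT)φ⟩`. Indeed `H(Aφ) = A(Hφ) + [T, A]φ`
(`[D, A] = 0`), `Hφ = E₀(N)φ`, and `E₀(M)‖Aφ‖² ≤ Re⟨Aφ, H Aφ⟩` by the variational principle.
Feynman (1954), used one-sided. [folklore] -/
theorem singleMode_bound (H T D A : Matrix (Finset ι) (Finset ι) ℂ) (U : ℂ)
    (hHT : H = T + U • D) (hA : A * D = D * A) {N M : ℕ} {φ : Fock ι}
    (hGS : IsGroundState H N φ) (hM : IsNParticle M (A *ᵥ φ)) :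
    (star (A *ᵥ φ) ⬝ᵥ (A *ᵥ φ)).re * (groundEnergy H M - groundEnergy H N) ≤
      (star (A *ᵥ φ) ⬝ᵥ ((T * A - A * T) *ᵥ φ)).re := by
  obtain ⟨-, -, heig⟩ := hGS
  have hvar := LiebThm1.groundEnergy_mul_norm_le H hM
  have hcomm : H * A = A * H + (T * A - A * T) := by
    rw [hHT, Matrix.add_mul, Matrix.mul_add, Matrix.smul_mul, Matrix.mul_smul, hA]
    abel
  have hHχ : H *ᵥ (A *ᵥ φ) =
      ((groundEnergy H N : ℝ) : ℂ) • (A *ᵥ φ) + (T * A - A * T) *ᵥ φ := by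
    rw [Matrix.mulVec_mulVec, hcomm, Matrix.add_mulVec, ← Matrix.mulVec_mulVec, heig,
      Matrix.mulVec_smul]
  have hexp : expect H (A *ᵥ φ) =
      ((groundEnergy H N : ℝ) : ℂ) * (star (A *ᵥ φ) ⬝ᵥ (A *ᵥ φ)) +
        star (A *ᵥ φ) ⬝ᵥ ((T * A - A * T) *ᵥ φ) := by
    rw [expect, hHχ, dotProduct_add, dotProduct_smul, smul_eq_mul]
  rw [hexp, Complex.add_re, Complex.re_ofReal_mul] at hvar
  nlinarith [hvar]

end SingleMode

/-- **`ProjectedSingleModeBound`** (route `ParentFirstSMA`, item stmt-HubbardSuperconductivity-2357):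
Feynman's single-mode bound for doublon-commuting modes of the Hubbard torus,
`‖Aφ‖² (E(M) − E(N)) ≤ Re⟨Aφ, [T, A]φ⟩` — the repulsion `U` drops out exactly.
[cite: LiebWuPhysicaA2003, §1 eq. (3)] -/
theorem projectedSingleModeBound_proof : ProjectedSingleModeBound := by
  intro U L N M A φ hGS hA hM
  have hHT : hubbardTorus 2 L 1 U = hubbardTorus 2 L 1 0 +
      (U : ℂ) • ∑ x : FermionTorus 2 L, numberOp x 0 * numberOp x 1 := by
    simp only [hubbardTorus, hamiltonian, Complex.ofReal_zero, zero_smul, add_zero]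
  exact singleMode_bound _ _ _ _ _ hHT hA hGS hM

/-! ### The projected hole re-creation operator commutes with the doublon number -/

section HoleWave

-- The `DecidableEq (Finset (Orb Λ))` instance behind `1 : Matrix _ _ ℂ` is taken as a parameter so
-- that the lemmas unify with route statements whichever instance path those were elaborated with.
variable {Λ : Type*} [LinearOrder Λ] [Fintype Λ]

/-- `n_{xσ}² = n_{xσ}`. [folklore] -/
theorem numberOp_mul_self (x : Λ) (σ : Fin 2) : numberOp x σ * numberOp x σ = numberOp x σ :=
  (numberAt_idempotent (orb x σ)).eq

/-- `c†_{x↓}(1 − n_{x↑})` commutes with every `n_{y↑} n_{y↓}`: for `y ≠ x` all four number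
operators commute with it; for `y = x` both products vanish (`n_{x↑}(1 − n_{x↑}) = 0`,
`c†_{x↓} n_{x↓} = 0`, `n_{x↓} c†_{x↓} = c†_{x↓}`). Essler et al. (2005) §2.1. [folklore] -/
theorem holeCreation_commute_doublon [DecidableEq (Finset (Orb Λ))] (x y : Λ) :
    Commute (creation (orb x 1) * (1 - numberOp x 0)) (numberOp y 0 * numberOp y 1) := by
  change creation (orb x 1) * (1 - numberOp x 0) * (numberOp y 0 * numberOp y 1) =
    numberOp y 0 * numberOp y 1 * (creation (orb x 1) * (1 - numberOp x 0))
  by_cases hxy : y = x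
  · subst hxy
    have hid : numberOp y 0 * numberOp y 0 = numberOp y 0 := numberOp_mul_self y 0
    have h1 : (1 - numberOp y 0) * numberOp y 0 = 0 := by
      rw [sub_mul, one_mul, hid, sub_self]
    have h2 : numberOp y 0 * (1 - numberOp y 0) = 0 := by
      rw [mul_sub, mul_one, hid, sub_self]
    have hn1c : numberOp y 1 * creation (orb y 1) = creation (orb y 1) :=
      number_mul_creation_self (orb y 1)
    have hne : orb y 0 ≠ orb y 1 := by
      rw [Ne, orb_eq_orb_iff]
      simp
    have hn0c : numberOp y 0 * creation (orb y 1) = creation (orb y 1) * numberOp y 0 :=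
      number_mul_creation_of_ne hne
    have hL : creation (orb y 1) * (1 - numberOp y 0) * (numberOp y 0 * numberOp y 1) = 0 := by
      rw [mul_assoc, ← mul_assoc (1 - numberOp y 0), h1, zero_mul, mul_zero]
    have hR : numberOp y 0 * numberOp y 1 * (creation (orb y 1) * (1 - numberOp y 0)) = 0 := by
      calc numberOp y 0 * numberOp y 1 * (creation (orb y 1) * (1 - numberOp y 0))
          = numberOp y 0 * (numberOp y 1 * creation (orb y 1)) * (1 - numberOp y 0) := by
            simp only [mul_assoc]
        _ = creation (orb y 1) * (numberOp y 0 * (1 - numberOp y 0)) := by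
            rw [hn1c, hn0c, mul_assoc]
        _ = 0 := by rw [h2, mul_zero]
    rw [hL, hR]
  · have hne0 : orb y 0 ≠ orb x 1 := by
      rw [Ne, orb_eq_orb_iff]
      simp [hxy]
    have hne1 : orb y 1 ≠ orb x 1 := by
      rw [Ne, orb_eq_orb_iff]
      simp [hxy]
    have hc0 : numberOp y 0 * creation (orb x 1) = creation (orb x 1) * numberOp y 0 :=
      number_mul_creation_of_ne hne0
    have hc1 : numberOp y 1 * creation (orb x 1) = creation (orb x 1) * numberOp y 1 :=
      number_mul_creation_of_ne hne1
    have hn0 : numberOp y 0 * numberOp x 0 = numberOp x 0 * numberOp y 0 :=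
      (numberAt_commute (orb y 0) (orb x 0)).eq
    have hn1 : numberOp y 1 * numberOp x 0 = numberOp x 0 * numberOp y 1 :=
      (numberAt_commute (orb y 1) (orb x 0)).eq
    have hB0 : numberOp y 0 * (creation (orb x 1) * (1 - numberOp x 0)) =
        creation (orb x 1) * (1 - numberOp x 0) * numberOp y 0 := by
      rw [← mul_assoc, hc0, mul_assoc, mul_assoc, mul_sub, sub_mul, mul_one, one_mul, hn0]
    have hB1 : numberOp y 1 * (creation (orb x 1) * (1 - numberOp x 0)) =
        creation (orb x 1) * (1 - numberOp x 0) * numberOp y 1 := by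
      rw [← mul_assoc, hc1, mul_assoc, mul_assoc, mul_sub, sub_mul, mul_one, one_mul, hn1]
    calc creation (orb x 1) * (1 - numberOp x 0) * (numberOp y 0 * numberOp y 1)
        = (creation (orb x 1) * (1 - numberOp x 0) * numberOp y 0) * numberOp y 1 := by
          rw [← mul_assoc]
      _ = numberOp y 0 * (creation (orb x 1) * (1 - numberOp x 0) * numberOp y 1) := by
          rw [← hB0, mul_assoc]
      _ = numberOp y 0 * numberOp y 1 * (creation (orb x 1) * (1 - numberOp x 0)) := by
          rw [← hB1, mul_assoc]

/-- A projected hole wave `Σ_x c_x • c†_{x↓}(1 − n_{x↑})` commutes with the doublon number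
`Σ_y n_{y↑} n_{y↓}`. [folklore] -/
theorem holeWave_commute_doublon [DecidableEq (Finset (Orb Λ))] (c : Λ → ℂ) :
    Commute (∑ x, c x • (creation (orb x 1) * (1 - numberOp x 0)))
      (∑ y, numberOp y 0 * numberOp y 1) :=
  Commute.sum_left _ _ _ fun x _ =>
    Commute.smul_left (Commute.sum_right _ _ _ fun y _ => holeCreation_commute_doublon x y) (c x)

/-- `1 − n_{x↑}` preserves the particle number (`n_{x↑}` is the occupation indicator,
`LiebTwo.numberOp_mulVec`). [folklore] -/
theorem isNParticle_one_sub_numberOp_mulVec [DecidableEq (Finset (Orb Λ))] (x : Λ) {N : ℕ} {φ : Fock (Orb Λ)}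
    (hφ : IsNParticle N φ) : IsNParticle N ((1 - numberOp x 0) *ᵥ φ) := by
  intro s hs
  rw [Matrix.sub_mulVec, Matrix.one_mulVec, Pi.sub_apply, LiebTwo.numberOp_mulVec, hφ s hs]
  split_ifs <;> simp

/-- `c • c†_{x↓}(1 − n_{x↑})` raises the particle number by one. [folklore] -/
theorem isNParticle_smul_holeCreation_mulVec [DecidableEq (Finset (Orb Λ))] (x : Λ) (c : ℂ) {N : ℕ} {φ : Fock (Orb Λ)}
    (hφ : IsNParticle N φ) :
    IsNParticle (N + 1) ((c • (creation (orb x 1) * (1 - numberOp x 0))) *ᵥ φ) := by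
  rw [Matrix.smul_mulVec, ← Matrix.mulVec_mulVec]
  intro s hs
  rw [Pi.smul_apply, IsNParticle.creation_mulVec_holds (isNParticle_one_sub_numberOp_mulVec x hφ)
    (orb x 1) s hs, smul_zero]

/-- A projected hole wave raises the particle number by one: if `φ` is an `N`-particle vector
then `(Σ_x c_x • c†_{x↓}(1 − n_{x↑})) φ` is an `(N+1)`-particle vector. [folklore] -/
theorem isNParticle_holeWave_mulVec [DecidableEq (Finset (Orb Λ))] (c : Λ → ℂ) {N : ℕ} {φ : Fock (Orb Λ)}
    (hφ : IsNParticle N φ) :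
    IsNParticle (N + 1) ((∑ x, c x • (creation (orb x 1) * (1 - numberOp x 0))) *ᵥ φ) := by
  rw [Matrix.sum_mulVec]
  have hmem : ∀ x ∈ (Finset.univ : Finset Λ),
      (c x • (creation (orb x 1) * (1 - numberOp x 0))) *ᵥ φ ∈ nParticleSubmodule (N + 1) :=
    fun x _ => (mem_nParticleSubmodule_iff _ _).2 (isNParticle_smul_holeCreation_mulVec x (c x) hφ)
  exact (mem_nParticleSubmodule_iff _ _).1 ((nParticleSubmodule (N + 1)).sum_mem hmem)

end HoleWave

/-! ### The Mott gap from a coherent hole -/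

/-- **`MottGapFromSingleMode`** (route `ParentFirstSMA`, item stmt-HubbardSuperconductivity-2358):
for even `L ≥ 2`, every momentum `k` and every ground state `φ` of `hubbardTorus 2 L 1 U` in the
`(L² − 1)`-particle sector, `Z (U − Δ_c(L)) ≤ 2f` with `Z = ‖Pφ‖²`, `f = Re⟨Pφ, [T, P]φ⟩`,
`P = Σ_x e^{2πik·x/L} c†_{x↓}(1 − n_{x↑})`: particle–hole symmetry `E(L²−1) = E(L²+1) − U` turns
Feynman's upper bound into a lower bound on the Mott gap. [cite: LiebWuPhysicaA2003, §1 eq. (3)] -/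
theorem mottGapFromSingleMode_proof : MottGapFromSingleMode := by
  intro U L k φ hL h2 hGS P
  have hL1 : 1 ≤ L ^ 2 := Nat.one_le_pow _ _ (by omega)
  -- the projected hole wave commutes with the doublon number and raises `N` by one
  have hA : P * (∑ x : FermionTorus 2 L, numberOp x 0 * numberOp x 1) =
      (∑ x : FermionTorus 2 L, numberOp x 0 * numberOp x 1) * P :=
    (holeWave_commute_doublon _).eq
  have hM : IsNParticle (L ^ 2) (P *ᵥ φ) := by
    have h := isNParticle_holeWave_mulVec
      (fun x : FermionTorus 2 L => Complex.exp (2 * Real.pi * Complex.I *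
        (∑ i : Fin 2, ((ofLex x i : ℕ) : ℂ) * ((k i : ℕ) : ℂ)) / (L : ℂ))) hGS.1
    rwa [Nat.sub_add_cancel hL1] at h
  -- Feynman's bound with `N = L² − 1`, `M = L²`
  have hsm := projectedSingleModeBound_proof U L (L ^ 2 - 1) (L ^ 2) P φ hGS hA hM
  -- particle–hole symmetry: `E(L² − 1) = E(L² + 1) − U`
  have hph := groundEnergyAt_fermionTorus_particleHole (d := 2) hL 1 U (N := L ^ 2 - 1)
    (by omega)
  have hK : 2 * L ^ 2 - (L ^ 2 - 1) = L ^ 2 + 1 := by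
    generalize L ^ 2 = K at hL1 ⊢
    omega
  rw [hK] at hph
  have hcast : ((L : ℝ) ^ 2 - ((L ^ 2 - 1 : ℕ) : ℝ)) = 1 := by
    rw [Nat.cast_sub hL1]
    push_cast
    ring
  rw [hcast, one_mul] at hph
  -- bookkeeping
  unfold chargeGap
  rw [hph] at hsm ⊢
  have hZ : (star (P *ᵥ φ) ⬝ᵥ (P *ᵥ φ)).re *
      (U - (groundEnergyAt (fermionTorusGraph 2 L) 1 U (L ^ 2 + 1) +
        (groundEnergyAt (fermionTorusGraph 2 L) 1 U (L ^ 2 + 1) - U) -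
          2 * groundEnergyAt (fermionTorusGraph 2 L) 1 U (L ^ 2))) =
      2 * ((star (P *ᵥ φ) ⬝ᵥ (P *ᵥ φ)).re *
        (groundEnergyAt (fermionTorusGraph 2 L) 1 U (L ^ 2) -
          (groundEnergyAt (fermionTorusGraph 2 L) 1 U (L ^ 2 + 1) - U))) := by
    ring
  rw [hZ]
  linarith [hsm]

/-- **`Assembly`** of route `ParentFirstSMA` (item stmt-HubbardSuperconductivity-2359):
`HoleSingleModeBelowHalfU → BoundCoherentDWavePairs → DiluteDWavePairsCondense →
HubbardSuperconductivity`, the route's deciding theorem with the support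
`MottGapFromSingleMode` discharged. [cite: Scalapino1995, §2 eq. (2.4)] -/
theorem parentFirstSMA_assembly_proof : Assembly :=
  fun h₁ h₂ h₃ => closes h₁ h₂ h₃ mottGapFromSingleMode_proof

end Summit.HubbardSuperconductivity.HubbardSuperconductivity.Theorems.ParentFirstSMA

end
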